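import Summits.ValiantsHypothesis.ValiantsHypothesis.Theses.FreeSubtorus
import Literature.Computability.AlgebraicComplexity.GrenetEquivariant

/-!
# `FreeSubtorus.OrbitDimensionBound` (stmt-ValiantsHypothesis-16133): a homothety gap refutes the crux

Negative knowledge for the crux (standing disprover, cycle 1, 2026-08-17).  Every ADMISSIBLE
subtorus `T_Λ` of the crux (relations with zero row-sums and column-sums, any rank) contains every
homothety `x ↦ c·x` (generator `(d, e) = (c·𝟙, 𝟙)`: each relation evaluates to `c^{row-sum} = 1`,
`scalar_mem_admissibleClosure`).  Hence `OrbitDimensionBound` forces, at every size `m ≥ dc(per_n)`,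
a representation with EXACT lifts of all homotheties; contrapositively, a single "homothety gap" —
a size `m` at which `per_n` (`n ≥ 3`) has a representation but no representation of size `m`
lifts some homothety exactly — refutes the crux (`not_orbitDimensionBound_of_homothetyGap`).
This isolates the weakest torus content of the crux (open for `n ≥ 4` exactly where the crux is;
by `InPlaceFalse.lean` the gap cannot be closed in place).  Inline statements, no new facts.
-/

noncomputable section

namespace Summit.ValiantsHypothesis.Theorems.OrbitDimensionBoundNegative

open MvPolynomial Matrix
open Literature.Computability.AlgebraicComplexity

/-- `∏ c^{f k} = c^{Σ f k}` in a commutative group (integer exponents). [folklore] -/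
theorem prod_zpow_eq_zpow_sum_units {G ι : Type*} [CommGroup G] (c : G) (s : Finset ι) (f : ι → ℤ) :
    ∏ k ∈ s, c ^ f k = c ^ (∑ k ∈ s, f k) := by
  classical
  induction s using Finset.induction_on with
  | empty => simp
  | insert a s ha ih => rw [Finset.prod_insert ha, Finset.sum_insert ha, ih, _root_.zpow_add]

/-- **Every admissible subtorus contains every homothety**: if `γ` is the scalar substitution
`c ≠ 0`, then `γ ∈ T_Λ` for every family of relations with zero row-sums. [folklore] -/
theorem scalar_mem_admissibleClosure {n r : ℕ} {Λ : Fin r → (Fin n ⊕ Fin n) → ℤ}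
    (hΛ : ∀ i, (∑ k, Λ i (Sum.inl k)) = 0 ∧ (∑ l, Λ i (Sum.inr l)) = 0)
    (γ : GL (Fin n × Fin n) ℂ) {c : ℂ} (hc : c ≠ 0)
    (hγ : (γ : Matrix (Fin n × Fin n) (Fin n × Fin n) ℂ) = Matrix.diagonal fun _ => c) :
    γ ∈ Subgroup.closure {γ : Matrix.GeneralLinearGroup (Fin n × Fin n) ℂ | ∃ d e : Fin n → ℂˣ,
        (∀ i, (∏ k, (d k) ^ (Λ i (Sum.inl k))) * (∏ l, (e l) ^ (Λ i (Sum.inr l))) = 1) ∧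
        (γ : Matrix (Fin n × Fin n) (Fin n × Fin n) ℂ) =
          Matrix.diagonal (fun p => (d p.1 : ℂ) * (e p.2 : ℂ))} := by
  refine Subgroup.subset_closure ⟨fun _ => Units.mk0 c hc, fun _ => 1, fun i => ?_, ?_⟩
  · rw [prod_zpow_eq_zpow_sum_units, prod_zpow_eq_zpow_sum_units, (hΛ i).1, zpow_zero,
      _root_.one_zpow, mul_one]
  · rw [hγ]
    congr 1
    funext p
    simp

/-- **`OrbitDimensionBound` forces homothety symmetrisation at every size**: for `n ≥ 3`, if
`per_n` has a size-`m` representation then some size-`m` representation admits exact lifts of every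
scalar substitution. [folklore] -/
theorem homothetyLifts_of_orbitDimensionBound
    (h : Summit.ValiantsHypothesis.ValiantsHypothesis.Theses.FreeSubtorus.OrbitDimensionBound)
    {n : ℕ} (hn : 3 ≤ n) {m : ℕ} (A : Matrix (Fin m) (Fin m) (MvPolynomial (Fin n × Fin n) ℂ))
    (hA : IsAffineDetRepr (perPoly (Fin n) ℂ) A) :
    ∃ B : Matrix (Fin m) (Fin m) (MvPolynomial (Fin n × Fin n) ℂ),
      IsAffineDetRepr (perPoly (Fin n) ℂ) B ∧
      ∀ (γ : GL (Fin n × Fin n) ℂ) (c : ℂ), c ≠ 0 →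
        (γ : Matrix (Fin n × Fin n) (Fin n × Fin n) ℂ) = Matrix.diagonal (fun _ => c) →
        ∃ g h' : GL (Fin m) ℂ, Matrix.linSubstEntries γ B =
          (g : Matrix (Fin m) (Fin m) ℂ).map C * B * ((h'⁻¹ : GL (Fin m) ℂ) : Matrix (Fin m) (Fin m) ℂ).map C := by
  obtain ⟨B, r, Λ, -, hΛ, hB⟩ := h n hn m A hA
  exact ⟨B, hB.1, fun γ c hc hγ => hB.2 γ (scalar_mem_admissibleClosure hΛ γ hc hγ)⟩

/-- **A homothety gap refutes the crux**: if for some `n ≥ 3` and `m` the permanent `per_n` has a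
size-`m` affine determinantal representation, but every size-`m` representation fails to lift
some scalar substitution exactly, then `OrbitDimensionBound` is false. [folklore] -/
theorem not_orbitDimensionBound_of_homothetyGap
    (hgap : ∃ n : ℕ, 3 ≤ n ∧ ∃ m : ℕ,
      (∃ A : Matrix (Fin m) (Fin m) (MvPolynomial (Fin n × Fin n) ℂ), IsAffineDetRepr (perPoly (Fin n) ℂ) A) ∧
      ∀ B : Matrix (Fin m) (Fin m) (MvPolynomial (Fin n × Fin n) ℂ), IsAffineDetRepr (perPoly (Fin n) ℂ) B →
        ∃ (γ : GL (Fin n × Fin n) ℂ) (c : ℂ), c ≠ 0 ∧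
          (γ : Matrix (Fin n × Fin n) (Fin n × Fin n) ℂ) = Matrix.diagonal (fun _ => c) ∧
          ¬ ∃ g h' : GL (Fin m) ℂ, Matrix.linSubstEntries γ B =
            (g : Matrix (Fin m) (Fin m) ℂ).map C * B * ((h'⁻¹ : GL (Fin m) ℂ) : Matrix (Fin m) (Fin m) ℂ).map C) :
    ¬ Summit.ValiantsHypothesis.ValiantsHypothesis.Theses.FreeSubtorus.OrbitDimensionBound := by
  intro h
  obtain ⟨n, hn, m, ⟨A, hA⟩, hno⟩ := hgap
  obtain ⟨B, hB, hlift⟩ := homothetyLifts_of_orbitDimensionBound h hn A hA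
  obtain ⟨γ, c, hc, hγ, hneg⟩ := hno B hB
  exact hneg (hlift γ c hc hγ)

end Summit.ValiantsHypothesis.Theorems.OrbitDimensionBoundNegative

end
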